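import Summits.QuantumFields.YangMills.Theorems.UnitScaleTiltProp7CornerCombL1EngineScaled
import Summits.QuantumFields.YangMills.Theorems.UnitScaleTiltProp7CornerCombL1PointwiseRows
import Summits.QuantumFields.YangMills.Theorems.UnitScaleTiltProp7CornerCombStructure
import HarnessLib

/-!
# (n3)-COMB (II), row `hMcomb₂`, located difficulty H2-1 — THE `ℓ¹` PROPAGATION THEOREM ON `ℤᵈ`:
# the linearised cornered comb tower of ANY source, at a unitary background tower with small block loops, in `ℓ¹` with corner-localised reading

Crux `stmt-QuantumFields-19200` `MinimiserStabilityRegPr`, route-R E′ (A′)-on-Σ, P-A2 (β); supplier design (II) (★routeR-w1 g9 MASTER 6efb31c3 §4: H2-1), ★px17 g4's H-line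
(✓`Prop7LinearTowerDuhamel` ∕ H-4b: `hMcomb₂ ⟸ H2-1(E) ⟸` per-(l, j) `ℓ¹` bounds over the level-`l` cell of the HOMOGENEOUS propagations `P_{l←j+1}(s_j)` of the tied sources).
Width seat `ym3-torus-px18` (gen 4); `--kind proof --supports stmt-QuantumFields-19200 --as helper`; THEOREMS ONLY (0 `def`, 0 `sorry`); «(O2) groundwork — not consumed by any
displayed row before the freeze lifts»; count-neutral.  YM₃ on T³ is a ladder rung (R3), not Clay; nothing here is progress on the YM mass gap.

## The point
The assembled `ℤᵈ` statement behind H2-1's propagator half, with the structure decomposition HIDDEN: for a background `U₀` whose averaged tower `Ūᵏ = avgIter L U₀ k` is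
unitary-valued (`k ≤ n`) with block loops `‖W(Ūᵏ)(L•z,κ,r) − 1‖ ≤ α_k ≤ 1∕24` (`k < n`), and ANY source `Y`, the linearised cornered comb tower `Q_n Y` (✓p704390's recursion text
`hQ0`∕`hQs` — the family ★px17's H-4 propagator `P_{l←j+1}` satisfies by ✓H-1) obeys, over any finite set `Zk` of level-`n` sites with absorbing chain `Z` and localised reading
chains `U i w` (hypotheses; the member instantiates them with period cells ∕ cornered boxes):
`Σ_{z∈Zk}Σ_κ‖Q_n Y z κ‖ ≤ (Π_{m<n}w_m)·Σ_{y∈Z 0}Σ_ν‖Y y ν‖ + d·L·Σ_{i<n}(Π_{m<i}w_m)·Σ_{z∈Zk}Σ_κ(Σ_{x∈U i (L^{n−1−i}•z) 0}Σ_μ‖Y x μ‖ + Σ_{x∈U i (L^{n−1−i}•(z+e κ)) 0}Σ_μ‖Y x μ‖)`,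
`w_m := L·L⁻ᵈ + 2d·(210·α_m·(2d+2)L)`.  PROOF = ✓p704390 `cornerComb_structure` with `CM k G z := FhatCov L Ūᵏ G (L•z)` (families by ✓`exists_reduced_gauge_family`) ∘ ✓p711222 (p1)(p2)(p3)
∘ ✓`…CornerCombL1EngineScaled.sum_norm_le_localised_of_pointwise_scaled`.  In `d = 3`: `w_m = L⁻²(1 + 3360·L⁴·α_m)`, `Π_m(1 + 3360L⁴α_m) ≤ exp(3360L⁴Σα_m)` — geometric from the
top at `RegPr` (MASTER §1 row 4; member file).
* ★★★ `sum_norm_linTower_le_localised` — the row above.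
DEPENDENCE: weights closed in `(d, L, α_m)`; NOTHING reads `n` beyond the displayed products∕powers, nor the torus, `K`, the member.  NOT HERE: cells, the tied-source pricing
(✓p705643∕✓p706697∕✓p709510), windows from `RegPr`, the member (H2-1(E) supplier).
HONEST: an assembly of landed bookkeeping; nothing of H2-1's member ∕ `hMcomb₂` ∕ `hMcomb` ∕ (β) ∕ the crux is proved or claimed; rung R3 (YM₃ on T³), NOT d = 4, NOT infinite volume,
NOT Clay; YM gap NOT proved.  References: T. Bałaban, CMP 98 (1985) 17–51 [Balaban1985Averaging] ((42)–(43) pp.23–24, (112) p.34, (119) p.35, (124)–(126) p.36).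
-/

set_option autoImplicit false

noncomputable section

open scoped BigOperators
open Finset

namespace Summit.QuantumFields.YangMills.Theorems.Prop7CornerCombL1Propagation

open NormedSpace
open Literature.MathematicalPhysics.QuantumFieldTheory.Balaban1983to89
open ExpMeanLog (eml)
open B7Prop1Explicit (Site Letter e seg treeWord boxVec gammaWord Wcx Xavg bavg expUnit U1)
open B7Prop2Explicit (avgIter unitaryUnits unitaryUnits_le_U1)
open B7Eq78Linearization (conjR)
open B7Prop3GeneralRotated (tsum)
open B7Prop3GeneralLinear (FhatCov)
open Summit.QuantumFields.YangMills.Theorems.Prop7CornerCombStructure (cornerComb_structure exists_reduced_gauge_family)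
open Summit.QuantumFields.YangMills.Theorems.Prop7CornerCombL1PointwiseRows
  (norm_reduced_succ_le_pointwise norm_FhatCov_le_sum_steps norm_le_of_structure_pointwise)
open Summit.QuantumFields.YangMills.Theorems.Prop7CornerCombL1EngineScaled (sum_norm_le_localised_of_pointwise_scaled)

variable {d : ℕ} {𝔸 : Type*} [CStarAlgebra 𝔸] [Nontrivial 𝔸]

/-- ★★★ **THE `ℓ¹` PROPAGATION THEOREM ON `ℤᵈ` WITH CORNER-LOCALISED READING** (structure decomposition hidden).  Background `U₀` with `Ūᵏ` unitary-valued for `k ≤ n` and block loops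
`≤ α_k ≤ 1∕24` for `k < n` (`0 ≤ α_k`); ANY source `Y`; `Q` the linearised cornered comb tower (✓p704390's `hQ0`∕`hQs` text); absorbing chain `Z` with `Z n = Zk`; reading chains
`U i w` whose top contains the tree-word step sites from `L•w` and which absorb downwards.  Then, with `w_m := L·L⁻ᵈ + 2d·(210·α_m·((2d+2)·L))`,
`Σ_{z∈Zk}Σ_κ‖Q n Y z κ‖ ≤ (Π_{m<n}w_m)·Σ_{y∈Z 0}Σ_ν‖Y y ν‖ + d·L·Σ_{i<n}(Π_{m<i}w_m)·Σ_{z∈Zk}Σ_κ(Σ_{x∈U i (L^{n−1−i}•z) 0}Σ_μ‖Y x μ‖ + Σ_{x∈U i (L^{n−1−i}•(z+e κ)) 0}Σ_μ‖Y x μ‖)`.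
«(O2) groundwork.» [cite: Balaban1985Averaging, (42)–(43) pp.23–24, (112) p.34, (119) p.35, (124)–(126) p.36] -/
theorem sum_norm_linTower_le_localised (L : ℕ) (hL : 1 ≤ L) (U₀ : Site d → Fin d → 𝔸ˣ) (n : ℕ)
    (hV : ∀ k, k ≤ n → ∀ (x : Site d) (μ : Fin d), avgIter L U₀ k x μ ∈ unitaryUnits 𝔸)
    (α : ℕ → ℝ) (hα0 : ∀ k, 0 ≤ α k)
    (hα : ∀ k, k < n → ∀ (z : Site d) (κ : Fin d) (r : Fin d → Fin L),
      ‖((Wcx L (avgIter L U₀ k) ((L : ℤ) • z) κ (boxVec L r) : 𝔸ˣ) : 𝔸) - 1‖ ≤ α k)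
    (hα24 : ∀ k, k < n → α k ≤ 1 / 24)
    (Y : Site d → Fin d → 𝔸) (Q : ℕ → (Site d → Fin d → 𝔸) → Site d → Fin d → 𝔸) (hQ0 : Q 0 Y = Y)
    (hQs : ∀ (k : ℕ) (z : Site d) (κ : Fin d), Q (k + 1) Y z κ
      = fderiv ℂ (eml : ((Fin d → Fin L) → 𝔸) → 𝔸) (fun r => ((Wcx L (avgIter L U₀ k) ((L : ℤ) • z) κ (boxVec L r) : 𝔸ˣ) : 𝔸))
            (fun r => tsum (avgIter L U₀ k) (Q k Y) ((L : ℤ) • z) (gammaWord L κ (boxVec L r) ++ seg κ (-(L : ℤ)))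
              * ((Wcx L (avgIter L U₀ k) ((L : ℤ) • z) κ (boxVec L r) : 𝔸ˣ) : 𝔸))
            * (((expUnit (Xavg L (avgIter L U₀ k) ((L : ℤ) • z) κ))⁻¹ : 𝔸ˣ) : 𝔸)
          + ((expUnit (Xavg L (avgIter L U₀ k) ((L : ℤ) • z) κ) : 𝔸ˣ) : 𝔸) * tsum (avgIter L U₀ k) (Q k Y) ((L : ℤ) • z) (seg κ (L : ℤ))
            * (((expUnit (Xavg L (avgIter L U₀ k) ((L : ℤ) • z) κ))⁻¹ : 𝔸ˣ) : 𝔸))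
    (Zk : Finset (Site d)) (Z : ℕ → Finset (Site d)) (hZk : Z n = Zk)
    (hZ : ∀ m, m < n → ∀ z ∈ Z (m + 1), ∀ (κ : Fin d) (r : Fin d → Fin L) (t : ℕ), t < L → (L : ℤ) • z + boxVec L r + (t : ℤ) • e κ ∈ Z m)
    (hZ' : ∀ m, m < n → ∀ z ∈ Z (m + 1), ∀ (κ : Fin d) (s : Fin d → Fin L), (L : ℤ) • z + (L : ℤ) • e κ + boxVec L s ∈ Z m)
    (U : ℕ → Site d → ℕ → Finset (Site d))
    (hUtop : ∀ i, i < n → ∀ (w : Site d) (r : Fin d → Fin L),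
      ∀ s ∈ List.zip (List.scanl (fun (z : Site d) (l' : Letter d) => z + l'.vec) ((L : ℤ) • w) (treeWord (boxVec L r))) (treeWord (boxVec L r)),
        s.1 ∈ U i w i)
    (hU : ∀ i, i < n → ∀ (w : Site d), ∀ m, m < i → ∀ z ∈ U i w (m + 1), ∀ (κ : Fin d) (r : Fin d → Fin L) (t : ℕ), t < L →
      (L : ℤ) • z + boxVec L r + (t : ℤ) • e κ ∈ U i w m)
    (hU' : ∀ i, i < n → ∀ (w : Site d), ∀ m, m < i → ∀ z ∈ U i w (m + 1), ∀ (κ : Fin d) (s : Fin d → Fin L),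
      (L : ℤ) • z + (L : ℤ) • e κ + boxVec L s ∈ U i w m) :
    ∑ z ∈ Zk, ∑ κ : Fin d, ‖Q n Y z κ‖ ≤
      (∏ m ∈ Finset.range n, ((L : ℝ) * ((L : ℝ) ^ d)⁻¹ + 2 * d * (210 * α m * ((2 * d + 2) * L)))) * ∑ y ∈ Z 0, ∑ ν : Fin d, ‖Y y ν‖ +
        d * L * ∑ i ∈ Finset.range n, (∏ m ∈ Finset.range i, ((L : ℝ) * ((L : ℝ) ^ d)⁻¹ + 2 * d * (210 * α m * ((2 * d + 2) * L)))) *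
          ∑ z ∈ Zk, ∑ κ : Fin d,
            (∑ x ∈ U i (((L : ℤ) ^ (n - 1 - i)) • z) 0, ∑ μ : Fin d, ‖Y x μ‖ +
              ∑ x ∈ U i (((L : ℤ) ^ (n - 1 - i)) • (z + e κ)) 0, ∑ μ : Fin d, ‖Y x μ‖) := by
  have hV' : ∀ k, k ≤ n → ∀ (x : Site d) (μ : Fin d), avgIter L U₀ k x μ ∈ U1 𝔸 := fun k hk x μ => unitaryUnits_le_U1 (hV k hk x μ)
  -- the block-loop windows of `cornerComb_structure`
  have hW : ∀ k < n, ∀ (z : Site d) (κ : Fin d) (r : Fin d → Fin L),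
      ‖((Wcx L (avgIter L U₀ k) ((L : ℤ) • z) κ (boxVec L r) : 𝔸ˣ) : 𝔸) - 1‖ < 1 := by
    intro k hk z κ r
    have := hα k hk z κ r; have := hα24 k hk; linarith
  -- the reduced and gauge families for the corner maps `CM k G z := FhatCov L Ūᵏ G (L•z)`
  obtain ⟨G, Λ, hG0, hΛ0, hGs, hΛs⟩ := exists_reduced_gauge_family L U₀ Y
    (fun k (G : Site d → Fin d → 𝔸) (z : Site d) => FhatCov L (avgIter L U₀ k) G ((L : ℤ) • z))
  -- the structure identity at level n
  have hid := cornerComb_structure L U₀ Y n hW Q hQ0 hQs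
    (fun k (G : Site d → Fin d → 𝔸) (z : Site d) => FhatCov L (avgIter L U₀ k) G ((L : ℤ) • z)) G Λ hG0 hΛ0 hGs hΛs n le_rfl
  -- (p3): the structure bound
  have hQ : ∀ z ∈ Zk, ∀ κ : Fin d, ‖Q n Y z κ‖ ≤ ‖G n z κ‖ + ‖Λ n z‖ + ‖Λ n (z + e κ)‖ :=
    fun z _ κ => norm_le_of_structure_pointwise (hV' n le_rfl z κ) (hid z κ)
  -- (p1): the one-step domination at every level below n
  have hGs' := hGs
  beta_reduce at hGs'
  have hpt : ∀ m, m < n → ∀ (z : Site d) (κ : Fin d), ‖G (m + 1) z κ‖ ≤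
      ((L : ℝ) ^ d)⁻¹ * ∑ r : Fin d → Fin L, ∑ t ∈ Finset.range L, ‖G m ((L : ℤ) • z + boxVec L r + (t : ℤ) • e κ) κ‖ +
        (210 * α m * ((2 * d + 2) * L)) * ∑ s : Fin d → Fin L, ∑ ν : Fin d,
          (‖G m ((L : ℤ) • z + boxVec L s) ν‖ + ‖G m ((L : ℤ) • z + (L : ℤ) • e κ + boxVec L s) ν‖) :=
    fun m hm z κ => norm_reduced_succ_le_pointwise L hL U₀ m (hV m hm.le) G (hGs' m) (hα m hm) (hα24 m hm) z κ
  -- (p2): the corner frame reads the block at `L•y`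
  have hC : ∀ i, i < n → ∀ (y : Site d),
      ‖(fun k (G : Site d → Fin d → 𝔸) (z : Site d) => FhatCov L (avgIter L U₀ k) G ((L : ℤ) • z)) i (G i) y‖
        ≤ ∑ r : Fin d → Fin L, ((L : ℝ) ^ d)⁻¹ *
          ((List.zip (List.scanl (fun (z : Site d) (l' : Letter d) => z + l'.vec) ((L : ℤ) • y) (treeWord (boxVec L r))) (treeWord (boxVec L r))).map
            fun s => ‖G i s.1 s.2.1‖).sum := by
    intro i hi y
    beta_reduce
    exact norm_FhatCov_le_sum_steps L (hV' i hi.le) (G i) ((L : ℤ) • y)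
  -- the source is `G 0`
  have ha : ∀ m, 0 ≤ 210 * α m * ((2 * d + 2) * L) := fun m => by have := hα0 m; positivity
  have h := sum_norm_le_localised_of_pointwise_scaled L hL G (fun m => 210 * α m * ((2 * d + 2) * L)) ha
    (fun k (G : Site d → Fin d → 𝔸) (z : Site d) => FhatCov L (avgIter L U₀ k) G ((L : ℤ) • z)) Λ hΛ0 hΛs n (Q n Y) Zk hQ hpt hC
    Z hZk hZ hZ' U hUtop hU hU'
  rw [hG0] at h
  exact h

end Summit.QuantumFields.YangMills.Theorems.Prop7CornerCombL1Propagation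

end
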